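import Literature.NumberTheory.DiophantineGeometry.GarciaStichtenothTower
import Literature.NumberTheory.DiophantineGeometry.FunctionFieldDedekindKummer
import HarnessLib

/-!
# The Garcia–Stichtenoth tower: the places of the levels (Stichtenoth Lemmas 7.4.5–7.4.6,
[GS96, Lemmas 3.3–3.5])

Topic: `Literature/NumberTheory/DiophantineGeometry` (sub-namespace `GSTower`). For the levels
`G_N = GSTower.level K q N` of the tower `x_{i+1}^q - x_{i+1} = x_i^q/(1 - x_i^{q-1})` over a field `K`
of characteristic `p` with `q = pⁿ` and `𝔽_q ⊆ K`, we determine the local behaviour of the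
generators at EVERY place `Q` of `G_N` (`GSTower.Level.profile_level`):

* if `x₀` has a pole at `Q` then `Q = P_∞^{(N)}` (`Level.eq_Pinf_of_ord_neg`, total ramification);
* if `x₀(Q) ∉ 𝔽_q ∪ {∞}` then all `x_i` are finite at `Q` with `x_i(Q) ∉ 𝔽_q` and `Q` is unramified
  over `K(x₀)` (`Level.GenericProfile`; Lemma 7.4.5 / [GS96, Lemma 3.3 (iii)]);
* if `x₀(Q) = β ∈ 𝔽_q` then `Q` has a `Level.BadProfile Q β t α`: the orders of all `x_i`, the mirror
  congruences `x_{t+k} ≡ -α²/x_{t-k}` ([GS96, (3.4), (3.11)]) and hence the ramification index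
  `e(Q | x₀ = β) = q^{N-2t}` — the quantitative content of Lemma 7.4.6 (`d = 2e - 2`) in the form
  used by the genus computation of the sibling file.

Each step `G_{N+1} = G_N(x_{N+1})` is either unramified at `Q` (`u(x_N) = z^q - z + w`, `w ∈ 𝒪_Q`:
`FunctionFieldDedekindKummer` applied to `x_{N+1} - z`) or totally ramified (`v_Q(u(x_N)) = -1`:
`FunctionFieldTotallyRamifiedStep`); which case occurs is read off the level-`N` profile using the
expansions of `GarciaStichtenothLocal`.

## References

* H. Stichtenoth, *Algebraic Function Fields and Codes*, 2nd ed., GTM 254 (2009): Lemmas 7.4.3–7.4.6,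
  Prop. 3.7.8, 3.7.10. [Stichtenoth2009]
* A. Garcia, H. Stichtenoth, J. Number Theory 61 (1996) 248–273: Lemmas 3.2–3.6. [GarciaStichtenoth1996]
-/

noncomputable section

open scoped Classical Polynomial IntermediateField
open Polynomial

namespace Literature.NumberTheory.DiophantineGeometry

open AlgFunctionField

namespace GSTower.Level

variable {K : Type} [Field K] {q : ℕ} [hq : Fact (2 ≤ q)] (L : Level K q)

/-! ### The step `G_{N+1}/G_N` at a place: separability, unramified and ramified criteria -/

section Step

/-- `G_{N+1} = G_N(x_{N+1})`. [folklore] -/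
theorem adjoin_root_eq_top : L.carrier⟮AdjoinRoot.root L.poly⟯ = ⊤ := by
  apply IntermediateField.toSubalgebra_injective
  rw [IntermediateField.adjoin_simple_toSubalgebra_of_isAlgebraic
    (AdjoinRoot.isIntegral_root L.irreducible_poly.ne_zero).isAlgebraic, AdjoinRoot.adjoinRoot_eq_top,
    IntermediateField.top_toSubalgebra]

/-- `G_{N+1} = G_N(x_{N+1} - z)` for `z ∈ G_N`. [folklore] -/
theorem adjoin_root_sub_eq_top (z : L.carrier) :
    L.carrier⟮AdjoinRoot.root L.poly - algebraMap L.carrier L.Next z⟯ = ⊤ := by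
  rw [eq_top_iff, ← L.adjoin_root_eq_top, IntermediateField.adjoin_simple_le_iff]
  have h := add_mem (IntermediateField.mem_adjoin_simple_self L.carrier
    (AdjoinRoot.root L.poly - algebraMap L.carrier L.Next z))
    (IntermediateField.algebraMap_mem L.carrier⟮AdjoinRoot.root L.poly - algebraMap L.carrier L.Next z⟯ z)
  rwa [sub_add_cancel] at h

/-- `G_{N+1}/G_N` is separable when `q = 0` in `K` (`T^q - T - u` has derivative `-1`).
[cite: Stichtenoth2009, Lemma 7.4.3] -/
theorem isSeparable_next (hqK : (q : K) = 0) : Algebra.IsSeparable L.carrier L.Next := by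
  have hsep : L.poly.Separable := by
    have hqL : (q : L.carrier) = 0 := by rw [← map_natCast (algebraMap K L.carrier), hqK, map_zero]
    exact PlaceOver.separable_X_pow_sub_X_sub_C hqL _
  have hroot : IsSeparable L.carrier (AdjoinRoot.root L.poly) := by
    rw [IsSeparable, AdjoinRoot.minpoly_root L.irreducible_poly.ne_zero, L.monic_poly.leadingCoeff, inv_one,
      C_1, mul_one]
    exact hsep
  haveI : Algebra.IsSeparable L.carrier L.carrier⟮AdjoinRoot.root L.poly⟯ :=
    (IntermediateField.isSeparable_adjoin_simple_iff_isSeparable _ _).2 hroot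
  rw [L.adjoin_root_eq_top] at this
  exact Algebra.IsSeparable.of_algHom L.carrier _ (IntermediateField.topEquiv (F := L.carrier)
    (E := L.Next)).symm.toAlgHom

variable {p n : ℕ} [Fact p.Prime] [CharP K p]

omit [Fact p.Prime] in
/-- `q = pⁿ ≥ 2` vanishes in `K`. [folklore] -/
theorem cast_q_eq_zero (hqp : q = p ^ n) : (q : K) = 0 := by
  have hn : n ≠ 0 := by rintro rfl; have := hq.out; rw [hqp, pow_zero] at this; omega
  rw [hqp, Nat.cast_pow, CharP.cast_eq_zero K p, zero_pow hn]

omit [Fact p.Prime] hq in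
/-- The levels have characteristic `p`. [folklore] -/
theorem charP_carrier : CharP L.carrier p := charP_of_injective_algebraMap (algebraMap K L.carrier).injective p

omit hq in
/-- **Artin–Schreier shift** in the form `(y - z)^q - (y - z) = (y^q - y) - (z^q - z)`, `q = pⁿ`, in any
`K`-algebra field. [cite: Stichtenoth2009, Lemma 3.7.7 (proof)] -/
theorem sub_pow_q_sub_sub {F : Type*} [Field F] [Algebra K F] (hqp : q = p ^ n) (y z : F) :
    (y - z) ^ q - (y - z) = (y ^ q - y) - (z ^ q - z) := by
  haveI : CharP F p := charP_of_injective_algebraMap (algebraMap K F).injective p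
  subst hqp
  exact sub_pow_sub_sub n y z

/-- **Unramified step**: if `u(x_N) = z^q - z + w` with `w ∈ 𝒪_Q` (`Q = Q' ∩ G_N`), then `e(Q'|Q) = 1`
and `x_{N+1} - z ∈ 𝒪_{Q'}` (Kummer/Dedekind for the generator `x_{N+1} - z` of `G_{N+1}/G_N`, whose
minimal polynomial `T^q - T - w` has separable reduction). [cite: Stichtenoth2009, Prop. 3.7.10] -/
theorem unramified_next [Finite K] (hqp : q = p ^ n) {Q' : PlaceOver K L.Next} {z w : L.carrier}
    (hw : w ∈ (Q'.restrict (K := K) (F := L.carrier)).toValuationSubring)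
    (hu : u q (L.x L.N) = z ^ q - z + w) :
    Q'.ord (algebraMap L.carrier L.Next
      ((Q'.restrict (K := K) (F := L.carrier)).uniformizer : L.carrier)) = 1 ∧
    AdjoinRoot.root L.poly - algebraMap L.carrier L.Next z ∈ Q'.toValuationSubring := by
  have hqK : (q : K) = 0 := cast_q_eq_zero hqp
  haveI := L.isSeparable_next hqK
  have hy : (AdjoinRoot.root L.poly - algebraMap L.carrier L.Next z) ^ q -
      (AdjoinRoot.root L.poly - algebraMap L.carrier L.Next z) = algebraMap L.carrier L.Next w := by
    rw [sub_pow_q_sub_sub (K := K) hqp, L.root_pow_sub_root, hu, ← map_pow, ← map_sub, ← map_sub]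
    congr 1; ring
  exact ⟨PlaceOver.ord_algebraMap_uniformizer_eq_one_of_pow_sub_eq _ hq.out hqK hw hy
    (L.adjoin_root_sub_eq_top z) L.finrank_next rfl, PlaceOver.mem_of_pow_sub_eq rfl hq.out hy hw⟩

omit [Fact p.Prime] [CharP K p] in
/-- **Ramified step**: if `v_Q(u(x_N)) = -1` (`Q = Q' ∩ G_N`) then `v_{Q'}(x_{N+1}) = -1`, `e(Q'|Q) = q`,
`Q'` is the only place above `Q` and `deg Q' = deg Q`. [cite: Stichtenoth2009, Prop. 3.7.8] -/
theorem ramified_next {Q' : PlaceOver K L.Next}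
    (hu : (Q'.restrict (K := K) (F := L.carrier)).ord (u q (L.x L.N)) = -1) :
    Q'.ord (AdjoinRoot.root L.poly) = -1 ∧
    Q'.ord (algebraMap L.carrier L.Next
      ((Q'.restrict (K := K) (F := L.carrier)).uniformizer : L.carrier)) = q ∧
    (∀ Q'' : PlaceOver K L.Next, Q''.restrict (K := K) (F := L.carrier) =
      Q'.restrict (K := K) (F := L.carrier) → Q'' = Q') ∧
    Q'.degree = (Q'.restrict (K := K) (F := L.carrier)).degree := by
  obtain ⟨h1, h2, -, h4, h5⟩ := PlaceOver.totallyRamified_of_pow_sub_eq rfl hq.out L.finrank_next.le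
    L.root_pow_sub_root hu
  exact ⟨h1, h2, h4, h5⟩

omit [Fact p.Prime] [CharP K p] in
/-- Units of `𝒪_Q` are units of `𝒪_{Q'}` (`Q = Q' ∩ G_N`). [cite: Stichtenoth2009, Prop. 3.1.4] -/
theorem valuation_algebraMap_eq_one {Q' : PlaceOver K L.Next} {z : L.carrier}
    (hz : (Q'.restrict (K := K) (F := L.carrier)).valuation z = 1) :
    Q'.valuation (algebraMap L.carrier L.Next z) = 1 := by
  have hz0 : z ≠ 0 := by rintro rfl; rw [Valuation.map_zero] at hz; exact zero_ne_one hz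
  have h1 : z ∈ (Q'.restrict (K := K) (F := L.carrier)).toValuationSubring := by
    rw [← ValuationSubring.valuation_le_one_iff]; exact hz.le
  have h2 : z⁻¹ ∈ (Q'.restrict (K := K) (F := L.carrier)).toValuationSubring := by
    rw [← ValuationSubring.valuation_le_one_iff]
    change (Q'.restrict (K := K) (F := L.carrier)).valuation z⁻¹ ≤ 1
    rw [map_inv₀, hz, inv_one]
  rw [Q'.mem_restrict_iff (K := K) (F := L.carrier)] at h1 h2
  rw [map_inv₀] at h2
  apply le_antisymm ((Q'.toValuationSubring.valuation_le_one_iff _).2 h1)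
  have h3 := (Q'.toValuationSubring.valuation_le_one_iff _).2 h2
  rw [map_inv₀] at h3
  exact (inv_le_one₀ (zero_lt_iff.2 ((_root_.map_ne_zero _).2 ((_root_.map_ne_zero _).2 hz0)))).1 h3

omit [Fact p.Prime] [CharP K p] in
/-- Orders of elements of `G_N` above an unramified place. [cite: Stichtenoth2009, Prop. 3.1.4] -/
theorem ord_algebraMap_of_unramified {Q' : PlaceOver K L.Next}
    (he : Q'.ord (algebraMap L.carrier L.Next
      ((Q'.restrict (K := K) (F := L.carrier)).uniformizer : L.carrier)) = 1) (z : L.carrier) :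
    Q'.ord (algebraMap L.carrier L.Next z) = (Q'.restrict (K := K) (F := L.carrier)).ord z := by
  rw [Q'.ord_algebraMap_eq_mul (K := K) (F := L.carrier) z, he, one_mul]

omit [Fact p.Prime] [CharP K p] in
/-- Converse transfer: if `z ∈ G_N` is a unit at `Q'` then it is a unit at `Q = Q' ∩ G_N`.
[cite: Stichtenoth2009, Prop. 3.1.4] -/
theorem valuation_eq_one_of_algebraMap {Q' : PlaceOver K L.Next} {z : L.carrier}
    (hz : Q'.valuation (algebraMap L.carrier L.Next z) = 1) :
    (Q'.restrict (K := K) (F := L.carrier)).valuation z = 1 := by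
  have hz0 : z ≠ 0 := by
    rintro rfl; rw [map_zero, Valuation.map_zero] at hz; exact zero_ne_one hz
  have h1 : algebraMap L.carrier L.Next z ∈ Q'.toValuationSubring := by
    rw [← ValuationSubring.valuation_le_one_iff]; exact hz.le
  have h2 : (algebraMap L.carrier L.Next z)⁻¹ ∈ Q'.toValuationSubring := by
    rw [← ValuationSubring.valuation_le_one_iff]
    change Q'.valuation _ ≤ 1
    rw [map_inv₀, hz, inv_one]
  rw [← map_inv₀, ← Q'.mem_restrict_iff (K := K) (F := L.carrier)] at h2
  rw [← Q'.mem_restrict_iff (K := K) (F := L.carrier)] at h1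
  apply le_antisymm (((Q'.restrict (K := K) (F := L.carrier)).toValuationSubring.valuation_le_one_iff _).2 h1)
  have h3 := ((Q'.restrict (K := K) (F := L.carrier)).toValuationSubring.valuation_le_one_iff _).2 h2
  rw [map_inv₀] at h3
  exact (inv_le_one₀ (zero_lt_iff.2 ((_root_.map_ne_zero _).2 hz0))).1 h3

omit [Fact p.Prime] [CharP K p] in
/-- Zeros are seen above and below alike: `v_{Q'}(z) > 0 ↔ v_Q(z) > 0` for `z ∈ G_N`.
[cite: Stichtenoth2009, Prop. 3.1.4] -/
theorem ord_algebraMap_pos_iff (Q' : PlaceOver K L.Next) (z : L.carrier) :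
    0 < Q'.ord (algebraMap L.carrier L.Next z) ↔ 0 < (Q'.restrict (K := K) (F := L.carrier)).ord z := by
  rw [Q'.ord_algebraMap_eq_mul (K := K) (F := L.carrier) z]
  have he := Q'.one_le_ord_algebraMap_uniformizer (K := K) (F := L.carrier)
  constructor
  · intro h; by_contra h'; push Not at h'
    exact absurd h (not_lt.2 (mul_nonpos_of_nonneg_of_nonpos (by omega) h'))
  · intro h; exact mul_pos (by omega) h

end Step

/-! ### Places in general position -/

section Generic

variable {p n : ℕ} [Fact p.Prime] [CharP K p]

omit [Fact p.Prime] [CharP K p] hq in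
/-- In a linearly ordered value group, a product of two elements `≤ 1` equal to `1` has both factors
`1`. [folklore] -/
theorem eq_one_of_mul_eq_one_of_le {Γ : Type*} [LinearOrderedCommGroupWithZero Γ] {a b : Γ}
    (ha : a ≤ 1) (hb : b ≤ 1) (hab : a * b = 1) : a = 1 ∧ b = 1 := by
  have hb0 : b ≠ 0 := by rintro rfl; rw [mul_zero] at hab; exact zero_ne_one hab
  have ha0 : a ≠ 0 := by rintro rfl; rw [zero_mul] at hab; exact zero_ne_one hab
  rcases ha.lt_or_eq with ha' | ha'
  · exact absurd hab (ne_of_lt (by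
      calc a * b < 1 * b := mul_lt_mul_of_pos_right ha' (zero_lt_iff.2 hb0)
        _ ≤ 1 * 1 := by rw [one_mul, one_mul]; exact hb
        _ = 1 := one_mul 1))
  · refine ⟨ha', ?_⟩
    rwa [ha', one_mul] at hab

omit [Fact p.Prime] [CharP K p] in
/-- At a place in general position, `u(x_N)` is a unit. [cite: Stichtenoth2009, Lemma 7.4.5] -/
theorem valuation_u_eq_one {Q : PlaceOver K L.carrier} (h : L.GenericProfile Q) :
    Q.valuation (u q (L.x L.N)) = 1 := by
  have hq1 : q ≠ 0 := by have := hq.out; omega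
  have hx := h.mem L.N le_rfl
  have hv := h.valuation_eq_one L.N le_rfl
  have hfac : L.x L.N ^ q - L.x L.N = L.x L.N * -(1 - L.x L.N ^ (q - 1)) := by
    rw [neg_sub, mul_sub, mul_one, mul_pow_sub_one hq1]
  rw [hfac, Valuation.map_mul, Valuation.map_neg] at hv
  have h1 : Q.valuation (L.x L.N) ≤ 1 := (Q.toValuationSubring.valuation_le_one_iff _).2 hx
  have h2 : Q.valuation (1 - L.x L.N ^ (q - 1)) ≤ 1 :=
    (Q.toValuationSubring.valuation_le_one_iff _).2 (sub_mem (one_mem _) (pow_mem hx _))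
  obtain ⟨hvx, hv1⟩ := eq_one_of_mul_eq_one_of_le h1 h2 hv
  rw [u, map_div₀, Valuation.map_pow, hvx, hv1, one_pow, div_one]

/-- **The step `G_{N+1}/G_N` at a place in general position** ([GS96, Lemma 3.3 (iii)]; Lemma 7.4.5):
it is unramified, `x_{N+1}` is finite with residue outside `𝔽_q`, and the chart is inherited.
[cite: Stichtenoth2009, Lemma 7.4.5] [cite: GarciaStichtenoth1996, Lemma 3.3] -/
theorem genericProfile_next [Finite K] (hqp : q = p ^ n) {Q' : PlaceOver K L.Next}
    (h : L.GenericProfile (Q'.restrict (K := K) (F := L.carrier))) : L.next.GenericProfile Q' := by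
  have hw1 := L.valuation_u_eq_one h
  have hwO : u q (L.x L.N) ∈ (Q'.restrict (K := K) (F := L.carrier)).toValuationSubring :=
    ((PlaceOver.valuation_eq_one_iff _ _).1 hw1).1
  have hq1 : q ≠ 0 := by have := hq.out; omega
  obtain ⟨he, hy⟩ := L.unramified_next hqp (z := 0) hwO (by rw [zero_pow hq1, sub_zero, zero_add])
  rw [map_zero, sub_zero] at hy
  refine ⟨fun i hi => ?_, fun i hi => ?_, ?_⟩
  · rcases Nat.lt_succ_iff_lt_or_eq.1 (Nat.lt_succ_iff.2 (L.next_N ▸ hi)) with hi' | hi'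
    · rw [L.next_x_of_le (by omega)]
      exact (Q'.mem_restrict_iff (K := K) (F := L.carrier) _).1 (h.mem i (by omega))
    · rw [hi', L.next_x_succ]; exact hy
  · rcases Nat.lt_succ_iff_lt_or_eq.1 (Nat.lt_succ_iff.2 (L.next_N ▸ hi)) with hi' | hi'
    · rw [L.next_x_of_le (by omega), ← map_pow, ← map_sub]
      exact L.valuation_algebraMap_eq_one (h.valuation_eq_one i (by omega))
    · rw [hi', L.next_x_succ, L.root_pow_sub_root]
      exact L.valuation_algebraMap_eq_one hw1
  · obtain ⟨f, hf1, hfne, hf0⟩ := h.chart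
    refine ⟨f, ?_, ?_, ?_⟩
    · rw [L.next_x_of_le (Nat.zero_le _), aeval_algebraMap_apply, L.ord_algebraMap_of_unramified he, hf1]
    · rw [L.next_x_of_le (Nat.zero_le _), aeval_algebraMap_apply]
      exact (_root_.map_ne_zero _).2 hfne
    · rw [L.next_x_of_le (Nat.zero_le _), aeval_algebraMap_apply, L.ord_algebraMap_of_unramified he, hf0]

end Generic

/-! ### Places above `x₀ = β`, `β ∈ 𝔽_q`: the three cases of the step -/

section Bad

variable {p n : ℕ} [Fact p.Prime] [CharP K p]

omit hq in
/-- `(-b)^q = -b^q` for `q = pⁿ`. [folklore] -/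
theorem neg_pow_q {F : Type*} [Field F] [Algebra K F] (hqp : q = p ^ n) (b : F) : (-b) ^ q = -b ^ q := by
  haveI : CharP F p := charP_of_injective_algebraMap (algebraMap K F).injective p
  subst hqp
  rw [neg_pow, neg_one_pow_char_pow, neg_one_mul]

omit [Fact p.Prime] [CharP K p] in
/-- At a zero of `z`, `v(u(z)) = q v(z)` (`1 - z^{q-1}` is a unit). [cite: Stichtenoth2009, Lemma 7.4.6 (proof)] -/
theorem ord_u_of_ord_pos {F : Type*} [Field F] [Algebra K F] (P : PlaceOver K F) {z : F} (hz : 0 < P.ord z) :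
    u q z ≠ 0 ∧ P.ord (u q z) = q * P.ord z := by
  have hz0 : z ≠ 0 := P.ne_zero_of_ord_ne_zero hz.ne'
  have hq1 : 1 ≤ q - 1 := by have := hq.out; omega
  have hlt : P.ord (1 : F) < P.ord (-z ^ (q - 1)) := by
    rw [P.ord_one, P.ord_neg, P.ord_pow hz0]
    have : (1 : ℤ) ≤ ((q - 1 : ℕ) : ℤ) := by exact_mod_cast hq1
    nlinarith
  have hst := P.ord_add_eq_left_of_lt one_ne_zero (neg_ne_zero.2 (pow_ne_zero _ hz0)) hlt
  rw [← sub_eq_add_neg, P.ord_one] at hst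
  refine ⟨div_ne_zero (pow_ne_zero _ hz0) hst.1, ?_⟩
  rw [u, P.ord_div (pow_ne_zero _ hz0) hst.1, hst.2, sub_zero, P.ord_pow hz0]

/-- **The reduction of `u(x_N)` in the mirror case** `t ≤ N < 2t` ([GS96, (3.5)–(3.11)]): at a place
with `BadProfile Q β t α`, `u(x_N) = z^q - z + w` with `z = -α²/x_{2t-N-1}` and `w ∈ 𝒪_Q`.
[cite: Stichtenoth2009, Lemma 7.4.6 (proof)] [cite: GarciaStichtenoth1996, Lemma 3.4] -/
theorem exists_decomp_u_of_bad (hqp : q = p ^ n) {Q : PlaceOver K L.carrier} {β : K} {t : ℕ} {α : K}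
    (hbad : L.BadProfile Q β t α) (htN : t ≤ L.N) (h2t : L.N + 1 ≤ 2 * t) :
    ∃ w ∈ Q.toValuationSubring,
      u q (L.x L.N) = (-(algebraMap K L.carrier (α ^ 2) / L.x (2 * t - L.N - 1))) ^ q -
        (-(algebraMap K L.carrier (α ^ 2) / L.x (2 * t - L.N - 1))) + w := by
  haveI : CharP L.carrier p := L.charP_carrier
  have hqK : (q : K) = 0 := cast_q_eq_zero hqp
  have hq2 := hq.out
  set j := 2 * t - L.N - 1 with hj
  have hj1 : j + 1 = 2 * t - L.N := by omega
  have hjN : j < L.N := by omega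
  set a : L.carrier := algebraMap K L.carrier (α ^ 2) with ha
  have hxj : L.x j ≠ 0 := L.x_ne_zero hjN.le
  set U := u q (L.x j) with hU
  have hrel : L.x (j + 1) ^ q - L.x (j + 1) = U := L.rel j hjN
  -- `u(x_N) + a/U ∈ 𝒪_Q`
  have hsum : u q (L.x L.N) + a * U⁻¹ ∈ Q.toValuationSubring := by
    rcases htN.lt_or_eq with hlt | heq
    · -- `t < N`: `u(x_N) = -x_N + O(1) = a/x_k + O(1)`, `1/x_k = -1/U + O(1)`, `k = 2t - N = j + 1`
      have hk : j + 1 < t := by omega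
      have hordk : 0 < Q.ord (L.x (j + 1)) := by
        rw [hbad.ord_lt (j + 1) hk (by omega)]; positivity
      obtain ⟨-, -, hE1⟩ := inv_add_inv_mem_of_pow_sub_eq Q hq2 hordk hrel
      have hordN : Q.ord (L.x L.N) < 0 := by
        rw [hbad.ord_mid L.N hlt (by omega) le_rfl]
        exact neg_neg_of_pos (by positivity)
      have hE4 := u_add_self_mem Q hq2 hordN
      have hmir := hbad.mirror L.N hlt (by omega) le_rfl
      rw [← hj1] at hmir
      have : u q (L.x L.N) + a * U⁻¹ = (u q (L.x L.N) + L.x L.N) - (L.x L.N + a / L.x (j + 1)) +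
          a * ((L.x (j + 1))⁻¹ + U⁻¹) := by rw [div_eq_mul_inv]; ring
      rw [this]
      exact add_mem (sub_mem hE4 hmir) (mul_mem (Q.algebraMap_mem _) hE1)
    · -- `t = N`: `u(x_t) = a/(x_t - α) + O(1)`, `1/(x_t - α) = -1/U + O(1)`, `j + 1 = t`
      subst heq
      have hjt : j + 1 = L.N := by omega
      have hδ : 0 < Q.ord (L.x L.N - algebraMap K L.carrier α) := by
        rw [hbad.ord_t le_rfl]; positivity
      have hrel' : (L.x L.N - algebraMap K L.carrier α) ^ q - (L.x L.N - algebraMap K L.carrier α) = U := by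
        rw [sub_pow_q_sub_sub (K := K) hqp, ← map_pow, hbad.pow_eq, sub_self, sub_zero, ← hrel, hjt]
      obtain ⟨-, -, hE1⟩ := inv_add_inv_mem_of_pow_sub_eq Q hq2 hδ hrel'
      have hE3 := u_sub_div_mem Q hq2 hqK hbad.pow_eq hbad.ne_zero hδ
      have : u q (L.x L.N) + a * U⁻¹ = (u q (L.x L.N) - a / (L.x L.N - algebraMap K L.carrier α)) +
          a * ((L.x L.N - algebraMap K L.carrier α)⁻¹ + U⁻¹) := by rw [div_eq_mul_inv]; ring
      rw [this]
      exact add_mem hE3 (mul_mem (Q.algebraMap_mem _) hE1)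
  -- `z^q - z = -a/U`
  have haq : a ^ q = a := by rw [ha, ← map_pow, ← pow_mul, mul_comm, pow_mul, hbad.pow_eq]
  have hz : (-(a / L.x j)) ^ q - -(a / L.x j) = -(a * U⁻¹) := by
    rw [neg_pow_q (K := K) hqp, div_pow, haq, hU, inv_u (by omega) hxj]
    ring
  refine ⟨u q (L.x L.N) + a * U⁻¹, hsum, ?_⟩
  rw [hz]; ring

omit [Fact p.Prime] in
/-- **`v_Q(u(x_N)) = -1` in the ramified case** `2t ≤ N` at a place with `BadProfile Q β t α`
(`x_N` has a simple pole there, or, for `N = 0`, `u(x₀) = α²/(x₀ - α) + O(1)`).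
[cite: Stichtenoth2009, Lemma 7.4.6 (proof)] -/
theorem ord_u_of_bad (hqp : q = p ^ n) {Q : PlaceOver K L.carrier} {β : K} {t : ℕ} {α : K}
    (hbad : L.BadProfile Q β t α) (h2t : 2 * t ≤ L.N) : Q.ord (u q (L.x L.N)) = -1 := by
  have hqK : (q : K) = 0 := cast_q_eq_zero hqp
  have hq2 := hq.out
  rcases Nat.eq_zero_or_pos L.N with hN0 | hNpos
  · -- `N = 0`, `t = 0`, `β = α ≠ 0`
    have ht0 : t = 0 := by omega
    have hβ : β ≠ 0 := fun hβ => by have := hbad.one_le_t hβ; omega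
    have hord : Q.ord (L.x 0 - algebraMap K L.carrier α) = 1 := by
      have := hbad.ord_t (by omega); rw [ht0, hN0] at this; simpa using this
    rw [hN0]
    have hδ0 : L.x 0 - algebraMap K L.carrier α ≠ 0 := Q.ne_zero_of_ord_ne_zero (by rw [hord]; norm_num)
    have ha0 : algebraMap K L.carrier (α ^ 2) ≠ 0 := (_root_.map_ne_zero _).2 (pow_ne_zero _ hbad.ne_zero)
    have hE3 := u_sub_div_mem Q hq2 hqK hbad.pow_eq hbad.ne_zero (by rw [hord]; exact one_pos)
    have hdiv : Q.ord (algebraMap K L.carrier (α ^ 2) / (L.x 0 - algebraMap K L.carrier α)) = -1 := by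
      rw [Q.ord_div ha0 hδ0, hord, PlaceOver.ord_algebraMap_holds Q (pow_ne_zero _ hbad.ne_zero)]; norm_num
    by_cases hw0 : u q (L.x 0) - algebraMap K L.carrier (α ^ 2) / (L.x 0 - algebraMap K L.carrier α) = 0
    · rw [sub_eq_zero.1 hw0, hdiv]
    · have hlt : Q.ord (algebraMap K L.carrier (α ^ 2) / (L.x 0 - algebraMap K L.carrier α)) <
          Q.ord (u q (L.x 0) - algebraMap K L.carrier (α ^ 2) / (L.x 0 - algebraMap K L.carrier α)) := by
        rw [hdiv]; have := Q.ord_nonneg_of_mem hE3; omega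
      have hst := Q.ord_add_eq_left_of_lt (div_ne_zero ha0 hδ0) hw0 hlt
      rw [add_sub_cancel, hdiv] at hst
      exact hst.2
  · -- `N ≥ 1`: `v(x_N) = -1` and `u(x_N) = -x_N + O(1)`
    have hordN : Q.ord (L.x L.N) = -1 := by
      rcases h2t.lt_or_eq with hlt | heq
      · rw [hbad.ord_gt L.N hlt le_rfl, Nat.sub_self, pow_zero]
      · have ht : 0 < t := by omega
        rw [hbad.ord_mid L.N (by omega) (by omega) le_rfl, ← heq, Nat.sub_self, pow_zero, mul_one]
    have hE4 := u_add_self_mem Q hq2 (by rw [hordN]; norm_num)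
    have hx0 : L.x L.N ≠ 0 := L.x_ne_zero le_rfl
    by_cases hw0 : u q (L.x L.N) + L.x L.N = 0
    · rw [eq_neg_of_add_eq_zero_left hw0, Q.ord_neg, hordN]
    · have hlt : Q.ord (-L.x L.N) < Q.ord (u q (L.x L.N) + L.x L.N) := by
        rw [Q.ord_neg, hordN]; have := Q.ord_nonneg_of_mem hE4; omega
      have hst := Q.ord_add_eq_left_of_lt (neg_ne_zero.2 hx0) hw0 hlt
      rw [show -L.x L.N + (u q (L.x L.N) + L.x L.N) = u q (L.x L.N) by ring, Q.ord_neg, hordN] at hst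
      exact hst.2

end Bad

end GSTower.Level

end Literature.NumberTheory.DiophantineGeometry
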